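import Literature.NumberTheory.EllipticCurves.EisensteinSeriesTwoCharacter
import Literature.NumberTheory.EllipticCurves.WeierstrassZetaDivisionValuesAtImInfty
import HarnessLib

/-!
# The weight-`1` Eisenstein series `S_1^{ψ,φ}` with two characters from corrected `ζ`-division
# values

Topic `Literature/NumberTheory/EllipticCurves`; namespace
`Literature.NumberTheory.EllipticCurves.ModularForms`.  Definitions with bodies (`eisensteinOneDivZ`,
`eisensteinOneDivConstZ`, `twoCharOne`, `twoCharOneCusp`, `twoCharOneMF`) and theorems; no named
fact.

For Dirichlet characters `ψ` modulo `u` and `φ` modulo `v` we form, exactly as the weight-`2`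
series `S_2^{ψ,φ}` from `℘`-division values (`EisensteinSeriesTwoCharacterWeightTwo`) and the
coprime-pairs series `E_k^{ψ,φ}` of weight `k ≥ 3` (`EisensteinSeriesTwoCharacter`), the
combination of corrected `ζ`-division values `Z_w` (`eisensteinOneDiv`,
`WeierstrassZetaDivisionValues`: `Z_w(τ) = ζ((c_wτ + d_w)/N; Λ_τ) - ((c_wτ+d_w)/N) G₂(τ) + 2πi c_w/N`,
`Z_w ∣₁ γ = Z_{wγ}`)

  `S_1^{ψ,φ}(τ) = ∑_{c₁ mod u} ∑_{d₀ mod uv} ψ(c₁) φ̄(d₀) Z_{(v c₁, d₀)}(τ)`,  `N = uv`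

(`twoCharOne`; Hecke 1927 §§1–3 and Diamond–Shurman §4.8: this is the weight-one Eisenstein series
`G_1^{ψ,φ}` of level `uv` in the lattice normalisation, `-2πi g(φ̄) v⁻¹ E_1^{ψ,φ}` up to the
normalising Gauss sum when `ψ`, `φ` are primitive).  Since `Z_w ∣₁ γ = Z_{wγ}` for ALL
`γ ∈ SL₂(ℤ)` (`eisensteinOneDiv_slash`), the proofs of the weight-`2` file carry over verbatim:

* `twoCharOne_slash_of_mem_gamma0` — `S ∣₁ γ = ψ(d) φ(d) S` for `γ ∈ Γ₀(uv)`;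
* `twoCharOneMF` — `S` as a modular form of weight `1` on `Γ₁(uv)` (holomorphy and boundedness at
  all cusps from `WeierstrassZetaDivisionValuesAtImInfty`);
* `tendsto_twoCharOne_slash_atImInfty` — the limit `twoCharOneCusp ψ φ γ` of `S ∣₁ γ` at `i∞` for
  every `γ ∈ SL₂(ℤ)`: a finite character sum of the constants
  `C_w = eisensteinOneDivConst` (`2πi B₁(c_w/N)` for `N ∤ c_w`, `π cot(π d_w/N)` for `N ∣ c_w`),
  i.e. of first Bernoulli numbers and cotangent (Gauss) sums — the constant terms
  `δ(ψ)L(0,φ) + δ(φ)L(0,ψ)`-type of the weight-one Eisenstein series at all cusps.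

## References

* E. Hecke, *Theorie der Eisensteinschen Reihen höherer Stufe und ihre Anwendung auf
  Funktionentheorie und Arithmetik*, Abh. Math. Sem. Hamburg 5 (1927), §§1–3.
* F. Diamond, J. Shurman, *A First Course in Modular Forms*, GTM 228 (2005), §4.8 (Thm. 4.8.1).
  [DiamondShurman2005]
-/

noncomputable section

open UpperHalfPlane hiding I
open EisensteinSeries ModularForm CongruenceSubgroup Complex Filter Function Matrix

open scoped Real MatrixGroups Topology Manifold

namespace Literature.NumberTheory.EllipticCurves.ModularForms

/-! ### Corrected `ζ`-division values indexed by `(ℤ/N)²` -/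

section OneDivZ

variable (N : ℕ) [NeZero N]

/-- The corrected `ζ`-division value `Z_a`, `a ∈ (ℤ/N)²` (through the canonical representatives).
[cite: DiamondShurman2005, §4.8] -/
def eisensteinOneDivZ (a : Fin 2 → ZMod N) : ℍ → ℂ :=
  eisensteinOneDiv N fun i ↦ ((a i).val : ℤ)

/-- `Z_a` computed from any integer lift of `a`. [folklore] -/
theorem eisensteinOneDivZ_eq_of_intCast (a : Fin 2 → ZMod N) (w : Fin 2 → ℤ)
    (h : ∀ i, (w i : ZMod N) = a i) : eisensteinOneDivZ N a = eisensteinOneDiv N w := by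
  funext τ
  refine eisensteinOneDiv_congr_mod (NeZero.ne N) (fun i ↦ ?_) τ
  rw [Int.cast_natCast, ZMod.natCast_zmod_val, h i]

/-- **`Z_a ∣₁ γ = Z_{aγ}`** for all `γ ∈ SL₂(ℤ)`. [cite: DiamondShurman2005, §4.8] -/
theorem eisensteinOneDivZ_slash (a : Fin 2 → ZMod N) (γ : SL(2, ℤ)) :
    (eisensteinOneDivZ N a) ∣[(1 : ℤ)] γ = eisensteinOneDivZ N (a ᵥ* γ) := by
  rw [eisensteinOneDivZ, eisensteinOneDiv_slash]
  symm
  refine eisensteinOneDivZ_eq_of_intCast N _ _ fun i ↦ ?_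
  simp only [Matrix.vecMul, dotProduct, Fin.sum_univ_two, Int.cast_add, Int.cast_mul,
    Int.cast_natCast, ZMod.natCast_zmod_val]
  fin_cases i <;> simp

/-- The constant `C_a` of `Z_a` at `i∞`. [cite: DiamondShurman2005, §4.8] -/
def eisensteinOneDivConstZ (a : Fin 2 → ZMod N) : ℂ :=
  eisensteinOneDivConst N fun i ↦ ((a i).val : ℤ)

/-- **`Z_a → C_a` at `i∞`.** [cite: DiamondShurman2005, §4.8] -/
theorem tendsto_eisensteinOneDivZ_atImInfty (a : Fin 2 → ZMod N) :
    Tendsto (eisensteinOneDivZ N a) atImInfty (𝓝 (eisensteinOneDivConstZ N a)) :=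
  tendsto_eisensteinOneDiv_atImInfty _

/-- `Z_a` is holomorphic. [folklore] -/
theorem mdifferentiable_eisensteinOneDivZ (a : Fin 2 → ZMod N) :
    MDifferentiable 𝓘(ℂ) 𝓘(ℂ) (eisensteinOneDivZ N a) :=
  mdifferentiable_eisensteinOneDiv _

/-- `C_a` computed from any integer lift of `a`. [folklore] -/
theorem eisensteinOneDivConstZ_eq_of_intCast (a : Fin 2 → ZMod N) (w : Fin 2 → ℤ)
    (h : ∀ i, (w i : ZMod N) = a i) : eisensteinOneDivConstZ N a = eisensteinOneDivConst N w := by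
  refine eisensteinOneDivConst_congr_mod (fun i ↦ ?_)
  rw [Int.cast_natCast, ZMod.natCast_zmod_val, h i]

end OneDivZ

/-! ### The two-character combination -/

section TwoChar

variable {u v : ℕ} [NeZero u] [NeZero v] (ψ : DirichletCharacter ℂ u) (φ : DirichletCharacter ℂ v)

/-- **`S_1^{ψ,φ} = ∑_{c₁ mod u} ∑_{d₀ mod uv} ψ(c₁) φ̄(d₀) Z_{(vc₁,d₀)}`**, the two-character
weight-one Eisenstein series of level `uv` in the lattice normalisation.
[cite: DiamondShurman2005, §4.8] -/
def twoCharOne : ℍ → ℂ := fun z ↦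
  ∑ c₁ : ZMod u, ∑ d₀ : ZMod (u * v), tcWeight ψ φ c₁ d₀ * eisensteinOneDivZ (u * v) (tcVec c₁ d₀) z

/-- `S_1^{ψ,φ}` as a sum of functions. [folklore] -/
theorem twoCharOne_eq_sum : twoCharOne ψ φ =
    ∑ c₁ : ZMod u, ∑ d₀ : ZMod (u * v),
      tcWeight ψ φ c₁ d₀ • eisensteinOneDivZ (u * v) (tcVec c₁ d₀) := by
  funext z
  simp [twoCharOne, Finset.sum_apply]

/-- **The nebentypus law**: `S ∣₁ γ = ψ(d) φ(d) S` for `γ = (a b; c d) ∈ Γ₀(uv)` (reindex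
`(c₁, d₀) ↦ (c₁ a, d₀ d + v c₁ b)`, verbatim as for `E_k^{ψ,φ}` and `S_2^{ψ,φ}`).
[cite: DiamondShurman2005, §4.8 (Thm. 4.8.1)] -/
theorem twoCharOne_slash_of_mem_gamma0 {γ : SL(2, ℤ)} (hγ : γ ∈ Gamma0 (u * v)) :
    twoCharOne ψ φ ∣[(1 : ℤ)] γ =
      (ψ ((γ 1 1 : ℤ) : ZMod u) * φ ((γ 1 1 : ℤ) : ZMod v)) • twoCharOne ψ φ := by
  have had_uv := apply_zero_zero_mul_apply_one_one_of_mem_gamma0 hγ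
  have had_u : ((γ 0 0 : ℤ) : ZMod u) * ((γ 1 1 : ℤ) : ZMod u) = 1 := by
    have := congrArg (ZMod.castHom (dvd_mul_right u v) (ZMod u)) had_uv
    rwa [map_mul, map_intCast, map_intCast, map_one] at this
  have had_v : ((γ 0 0 : ℤ) : ZMod v) * ((γ 1 1 : ℤ) : ZMod v) = 1 := by
    have := congrArg (ZMod.castHom (dvd_mul_left v u) (ZMod v)) had_uv
    rwa [map_mul, map_intCast, map_intCast, map_one] at this
  obtain ⟨dU, hdU⟩ : ∃ dU : (ZMod (u * v))ˣ, (dU : ZMod (u * v)) = ((γ 1 1 : ℤ) : ZMod (u * v)) :=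
    ⟨Units.mkOfMulEqOne (((γ 1 1 : ℤ) : ZMod (u * v))) (((γ 0 0 : ℤ) : ZMod (u * v)))
      ((mul_comm _ _).trans had_uv), rfl⟩
  obtain ⟨aU, haU⟩ : ∃ aU : (ZMod u)ˣ, (aU : ZMod u) = ((γ 0 0 : ℤ) : ZMod u) :=
    ⟨Units.mkOfMulEqOne (((γ 0 0 : ℤ) : ZMod u)) (((γ 1 1 : ℤ) : ZMod u)) had_u, rfl⟩
  rw [twoCharOne_eq_sum, SlashAction.sum_slash, Finset.smul_sum]
  simp_rw [SlashAction.sum_slash, ModularForm.SL_smul_slash, eisensteinOneDivZ_slash,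
    tcVec_vecMul_of_mem_gamma0 hγ, ← haU, ← hdU]
  refine Fintype.sum_equiv aU.mulRight _ _ fun c₁ ↦ ?_
  rw [Finset.smul_sum]
  refine Fintype.sum_equiv (dU.mulRight.trans (Equiv.addRight (vMul c₁ * ((γ 0 1 : ℤ) : ZMod (u * v)))))
    _ _ fun d₀ ↦ ?_
  simp only [Equiv.trans_apply, Units.mulRight_apply, Equiv.coe_addRight, smul_smul]
  congr 1
  simp only [tcWeight, map_add, map_mul, castHom_vMul, zero_mul, add_zero, map_intCast, hdU, haU]
  rw [MulChar.inv_apply_eq_inv' φ (((γ 1 1 : ℤ) : ZMod v))]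
  have hψ1 : ψ ((γ 1 1 : ℤ) : ZMod u) * ψ ((γ 0 0 : ℤ) : ZMod u) = 1 := by
    rw [← map_mul, mul_comm, had_u, map_one]
  have hφd : φ ((γ 1 1 : ℤ) : ZMod v) ≠ 0 := fun h ↦ by
    have := congrArg φ had_v
    rw [map_mul, h, mul_zero, map_one] at this
    exact zero_ne_one this
  have h2 : φ ((γ 1 1 : ℤ) : ZMod v) * (φ⁻¹ (ZMod.castHom (dvd_mul_left v u) (ZMod v) d₀) *
      (φ ((γ 1 1 : ℤ) : ZMod v))⁻¹) = φ⁻¹ (ZMod.castHom (dvd_mul_left v u) (ZMod v) d₀) := by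
    field_simp
  symm
  calc ψ ((γ 1 1 : ℤ) : ZMod u) * φ ((γ 1 1 : ℤ) : ZMod v) * (ψ c₁ * ψ ((γ 0 0 : ℤ) : ZMod u) *
        (φ⁻¹ (ZMod.castHom (dvd_mul_left v u) (ZMod v) d₀) * (φ ((γ 1 1 : ℤ) : ZMod v))⁻¹))
      = (ψ ((γ 1 1 : ℤ) : ZMod u) * ψ ((γ 0 0 : ℤ) : ZMod u)) * (ψ c₁ * (φ ((γ 1 1 : ℤ) : ZMod v) *
          (φ⁻¹ (ZMod.castHom (dvd_mul_left v u) (ZMod v) d₀) * (φ ((γ 1 1 : ℤ) : ZMod v))⁻¹))) := by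
        ring
    _ = ψ c₁ * φ⁻¹ (ZMod.castHom (dvd_mul_left v u) (ZMod v) d₀) := by rw [hψ1, h2, one_mul]

/-- Holomorphy of `S_1^{ψ,φ}`. [folklore] -/
theorem mdifferentiable_twoCharOne : MDifferentiable 𝓘(ℂ) 𝓘(ℂ) (twoCharOne ψ φ) := by
  rw [twoCharOne_eq_sum]
  have h1 : ∀ (c₁ : ZMod u) (s : Finset (ZMod (u * v))), MDifferentiable 𝓘(ℂ) 𝓘(ℂ)
      (∑ d₀ ∈ s, tcWeight ψ φ c₁ d₀ • eisensteinOneDivZ (u * v) (tcVec c₁ d₀)) := by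
    intro c₁ s
    induction s using Finset.induction_on with
    | empty => simp only [Finset.sum_empty]; exact mdifferentiable_const
    | insert d₀ s hd ih =>
      rw [Finset.sum_insert hd]
      exact ((mdifferentiable_eisensteinOneDivZ _ _).const_smul _).add ih
  have h2 : ∀ s : Finset (ZMod u), MDifferentiable 𝓘(ℂ) 𝓘(ℂ)
      (∑ c₁ ∈ s, ∑ d₀ : ZMod (u * v),
        tcWeight ψ φ c₁ d₀ • eisensteinOneDivZ (u * v) (tcVec c₁ d₀)) := by
    intro s
    induction s using Finset.induction_on with
    | empty => simp only [Finset.sum_empty]; exact mdifferentiable_const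
    | insert c₁ s hc ih =>
      rw [Finset.sum_insert hc]
      exact (h1 c₁ _).add ih
  exact h2 _

/-- **The constant of `S ∣₁ γ` at `i∞`**, `∑ ψ(c₁) φ̄(d₀) C_{(vc₁,d₀)γ}`: a finite character sum of
first Bernoulli numbers `2πi B₁(·/uv)` and cotangent values `π cot(π ·/uv)`.
[cite: DiamondShurman2005, §4.8] -/
def twoCharOneCusp (γ : SL(2, ℤ)) : ℂ :=
  ∑ c₁ : ZMod u, ∑ d₀ : ZMod (u * v),
    tcWeight ψ φ c₁ d₀ * eisensteinOneDivConstZ (u * v) ((tcVec c₁ d₀ : Fin 2 → ZMod (u * v)) ᵥ* γ)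

/-- **`S ∣₁ γ → twoCharOneCusp γ` at `i∞`** for every `γ ∈ SL₂(ℤ)`. [cite: DiamondShurman2005, §4.8] -/
theorem tendsto_twoCharOne_slash_atImInfty (γ : SL(2, ℤ)) :
    Tendsto (twoCharOne ψ φ ∣[(1 : ℤ)] γ) atImInfty (𝓝 (twoCharOneCusp ψ φ γ)) := by
  rw [twoCharOne_eq_sum, SlashAction.sum_slash]
  simp_rw [SlashAction.sum_slash, ModularForm.SL_smul_slash, eisensteinOneDivZ_slash]
  unfold twoCharOneCusp
  have : (fun z : ℍ ↦ ∑ c₁ : ZMod u, ∑ d₀ : ZMod (u * v), tcWeight ψ φ c₁ d₀ *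
      eisensteinOneDivZ (u * v) ((tcVec c₁ d₀ : Fin 2 → ZMod (u * v)) ᵥ* γ) z) =
      ∑ c₁ : ZMod u, ∑ d₀ : ZMod (u * v),
        tcWeight ψ φ c₁ d₀ • eisensteinOneDivZ (u * v) ((tcVec c₁ d₀ : Fin 2 → ZMod (u * v)) ᵥ* γ) := by
    funext z; simp [Finset.sum_apply]
  rw [← this]
  refine tendsto_finsetSum _ fun c₁ _ ↦ tendsto_finsetSum _ fun d₀ _ ↦ ?_
  exact (tendsto_eisensteinOneDivZ_atImInfty _ _).const_mul _

/-- Every `SL₂(ℤ)`-translate of `S_1^{ψ,φ}` is bounded at `i∞`. [folklore] -/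
theorem isBoundedAtImInfty_twoCharOne_slash (g : SL(2, ℤ)) :
    IsBoundedAtImInfty (twoCharOne ψ φ ∣[(1 : ℤ)] g) :=
  (tendsto_twoCharOne_slash_atImInfty ψ φ g).isBigO_one ℝ

/-- `S_1^{ψ,φ}` is invariant under `Γ₁(uv)`. [folklore] -/
theorem twoCharOne_slash_of_mem_gamma1 {γ : SL(2, ℤ)} (hγ : γ ∈ Gamma1 (u * v)) :
    twoCharOne ψ φ ∣[(1 : ℤ)] γ = twoCharOne ψ φ := by
  rw [Gamma1_mem] at hγ
  rw [twoCharOne_slash_of_mem_gamma0 ψ φ (Gamma0_mem.2 hγ.2.2)]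
  have hu : ((γ 1 1 : ℤ) : ZMod u) = 1 := by
    have := congrArg (ZMod.castHom (dvd_mul_right u v) (ZMod u)) hγ.2.1
    rwa [map_intCast, map_one] at this
  have hv : ((γ 1 1 : ℤ) : ZMod v) = 1 := by
    have := congrArg (ZMod.castHom (dvd_mul_left v u) (ZMod v)) hγ.2.1
    rwa [map_intCast, map_one] at this
  rw [hu, hv, map_one, map_one, one_mul, one_smul]

/-- **`S_1^{ψ,φ}` as a modular form of weight `1` on `Γ₁(uv)`.**
[cite: DiamondShurman2005, §4.8 (Thm. 4.8.1)] -/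
def twoCharOneMF : ModularForm (Gamma1 (u * v)) 1 where
  toFun := twoCharOne ψ φ
  slash_action_eq' A hA := by
    obtain ⟨A, (hA : A ∈ Gamma1 (u * v)), rfl⟩ := hA
    exact twoCharOne_slash_of_mem_gamma1 ψ φ hA
  holo' := mdifferentiable_twoCharOne ψ φ
  bdd_at_cusps' {c} hc := by
    rw [Subgroup.IsArithmetic.isCusp_iff_isCusp_SL2Z] at hc
    rw [OnePoint.isBoundedAt_iff_forall_SL2Z hc]
    intro γ _
    exact isBoundedAtImInfty_twoCharOne_slash ψ φ γ

/-- The function of `twoCharOneMF`. [folklore] -/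
@[simp] theorem coe_twoCharOneMF : (⇑(twoCharOneMF ψ φ) : ℍ → ℂ) = twoCharOne ψ φ := rfl

/-- Nebentypus law for the modular form. [cite: DiamondShurman2005, Thm. 4.8.1] -/
theorem twoCharOneMF_slash_of_mem_gamma0 {γ : SL(2, ℤ)} (hγ : γ ∈ Gamma0 (u * v)) :
    (⇑(twoCharOneMF ψ φ) : ℍ → ℂ) ∣[(1 : ℤ)] γ =
      (ψ ((γ 1 1 : ℤ) : ZMod u) * φ ((γ 1 1 : ℤ) : ZMod v)) • (⇑(twoCharOneMF ψ φ) : ℍ → ℂ) :=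
  twoCharOne_slash_of_mem_gamma0 ψ φ hγ

/-- Limits of the modular form at the cusps. [cite: DiamondShurman2005, §4.8] -/
theorem tendsto_twoCharOneMF_slash_atImInfty (γ : SL(2, ℤ)) :
    Tendsto ((⇑(twoCharOneMF ψ φ) : ℍ → ℂ) ∣[(1 : ℤ)] γ) atImInfty (𝓝 (twoCharOneCusp ψ φ γ)) :=
  tendsto_twoCharOne_slash_atImInfty ψ φ γ

end TwoChar

end Literature.NumberTheory.EllipticCurves.ModularForms
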